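import Literature.NumberTheory.EllipticCurves.AnticyclotomicSignedTransferTheorem
import Literature.NumberTheory.EllipticCurves.HeegnerFamilyScalingProofs
import HarnessLib

/-!
# The class binder of `AcSigned.TransferInputs` RESCALES: `(z, L) ↦ (u • z, j(ι u)²·L)` — hence a
# reversed-Howard ("Eisenstein-direction") statement quantified over every admissible class WITHOUT
# the BDP frame hypothesis is inconsistent (line `admdef`, crux `AnticyclotomicEisensteinDivisibility`,
# stmt-BirchSwinnertonDyer-20727: why the registered research stub keeps its `∃`-frame shape)

Lead seat bsd-line-sbc-p1 (gen 15), `--supports stmt-BirchSwinnertonDyer-20727`. The admdef supplement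
`Cruxes/…/Lines/admdef_transfer.lean` (rev 2) proposes to cut the load-bearing research stub C⁺⁺ of line
`admdef` down to a `±`-currency statement [R] `HPMCPlusRigidityRat` of the shape
"for EVERY class `z` and series `L` with `AcSigned.TransferInputs … ε z L`: ranks one and
`∃ k, (p^k)·char_t(X_ε) ⊆ ι(char(Sel_ε(K, 𝐓^ac)/Λz))²`". THIS FILE shows, in kernel, that such a
statement cannot be registered as it stands:

* §1 `TransferInputs.smul` — the six-field hypothesis structure of Castella–Wan's proof of Thm. 6.8
  is INVARIANT under rescaling the class by any `u ≠ 0` of `Λ` together with the series by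
  `j(ι u)²` (`j : ℤ_p → R₀` the structure map compatible with `ℤ_p ⊂ ℂ_p`, which is unique): the fields
  `torsionFree`, `exact613`, `exact612`, `lemma67` do not mention `(z, L)`; `signedLog_erl` rescales
  because the signed logarithm and `loc_𝔭` are `Λ`-linear; `loc_nonTorsion` because `Λ` is a domain.
* §2 `signedHeegnerCharIdeal_smul` — `char(Sel_ε/Λ(u•z)) = (u)·char(Sel_ε/Λz)` (the tree's
  `Module.charIdeal_quotient_span_smul_eq`, ARM P's Heegner-family rescaling lemma, on the signed carrier).
* §3 `Ideal.eq_bot_of_forall_span_C_pow_mul_le_span_X_pow` — an ideal `I` of `Λ = ℤ_p⟦T⟧` with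
  `∀ m, ∃ k, (p^k)·I ⊆ (T^m)` is `⊥` (coefficientwise: `p^k · a_n = 0 ⇒ a_n = 0`).
* §4 `TransferInputs.not_forall_reverseHoward` — THE TIGHTNESS: given ONE datum `(z₀, L₀)` with
  `TransferInputs … ε z₀ L₀` and `Sel_ε(K, 𝐓^ac)` of `Λ`-rank one, the statement "`∀ z L, TransferInputs …
  ε z L → ∃ k, (p^k)·char_t(X_ε) ⊆ ι(char(Sel_ε/Λz))²`" is FALSE (apply it to `z_m = ι(T^m) • z₀`:
  `(p^{k_m})·char_t(X_ε) ⊆ (T^{2m})` for all `m`, so `char_t(X_ε) = ⊥`, contradicting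
  `Module.charIdeal ≠ ⊥`); `…_hasRank_form` — the same for the supplement's exact three-conjunct shape
  (ranks one ∧ reversed inequality), where the rank hypothesis is supplied by the statement itself.
CONSEQUENCE for the line (recorded in `Lines/admdef.lean` v2 and `PICKED.md`): the Eisenstein-direction
residue in `±` currency must carry the frame hypothesis `IsCWBDPLFunction … L` (bdpline v33–v35 "Form T";
its class binder is then rigid, p678685 `…TransferClassRigidity`), equivalently stay in the `∃`-frame BDP
shape of C⁺⁺ / C⁺⁺_NS (frame concordance p634869). Castella–Wan never meet this because their `z` is THE
class `z^±_∞` and their `L` is `L_p^BDP`; the Howard direction (tree theorem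
`AcSigned.TransferInputs.mem_XAc_charIdeal_map_of_howard`) is stable under the rescaling and is unaffected.

All statements PROVED (standard axioms); no definition, no named fact, no `sorry`. Nothing about elliptic
curves is asserted unconditionally; BSD / the crux / C⁺⁺_NS are NOT proved by this file.
-/

-- D-0017: single-problem summit, the namespace repeats the problem name by design.
set_option linter.dupNamespace false
set_option autoImplicit false

noncomputable section

open scoped Classical

open PowerSeries NumberField IsDedekindDomain Field
open Literature.NumberTheory.EllipticCurves Literature.NumberTheory.GaloisRepresentations
open Literature.NumberTheory.EllipticCurves.AcSigned

universe u

namespace Summit.BirchSwinnertonDyer.BirchSwinnertonDyer.Theorems.SignedBaseChangeAcDivTransferInputsRescaling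

/-! ## §1 `TransferInputs` is invariant under `(z, L) ↦ (u • z, j(ι u)² · L)` -/

section Rescale

variable {K : Type u} [Field K] [NumberField K] {W : WeierstrassCurve K} {p : ℕ} [Fact p.Prime]
  {κ : ZpExtension K p} {γ : absoluteGaloisGroup K} {hγ : κ.IsTopGenerator γ}
  {𝔭 : HeightOneSpectrum (𝓞 K)} {h𝔭 : IsNonsplitIn κ 𝔭} {γ𝔭 : absoluteGaloisGroup (𝔭.adicCompletion K)}
  {hγ𝔭 : κ (resGalOfEmb (closureEmb (K := K) (𝔭.adicCompletion K)) γ𝔭) = κ γ}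
  {𝔭' : HeightOneSpectrum (𝓞 K)} {h𝔭𝔭' : 𝔭 ≠ 𝔭'} {h𝔭p : ((p : ℕ) : 𝓞 K) ∈ 𝔭.asIdeal} {ε : ℤˣ}
  {z : selmerLambdaAdic W p κ γ (fun _ ↦ .sgn ε)} {L : UnrSeries p}

/-- The structure map `ℤ_p → R₀` compatible with `ℤ_p ⊂ ℚ_p ⊂ ℂ_p` is unique (`R₀ ⊂ ℂ_p` is a subring).
[folklore] -/
theorem ringHom_eq_of_compatible (j j₀ : ℤ_[p] →+* unrIntegers p)
    (hj : ∀ x : ℤ_[p], ((j x : unrIntegers p) : ℂ_[p]) = algebraMap ℚ_[p] ℂ_[p] (x : ℚ_[p]))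
    (hj₀ : ∀ x : ℤ_[p], ((j₀ x : unrIntegers p) : ℂ_[p]) = algebraMap ℚ_[p] ℂ_[p] (x : ℚ_[p])) :
    j = j₀ :=
  RingHom.ext fun x ↦ Subtype.ext ((hj x).trans (hj₀ x).symm)

/-- **Rescaling invariance of Castella–Wan's transfer inputs (PROVED).** If `(z, L)` carries the six
fields of `AcSigned.TransferInputs` (proof of Thm. 6.8: [PR00] torsion-freeness, (6.13), (6.12),
Lemma 6.7 (2), Def. 6.1 + Thm. 6.2 as ideals, Cor. 6.4), then so does `(u • z, j₀(ι u)² · L)` for every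
`u ≠ 0` in `Λ` and the compatible structure map `j₀ : ℤ_p → R₀`: the first four fields do not involve
`(z, L)`; the explicit-reciprocity field rescales because `Log^ε_𝔭` and `loc_𝔭` are `Λ`-linear
(`IsSignedLog`, `locSignedAt_smul`) and the compatible `j` is unique; the non-torsion field because `Λ`
is a domain. So the structure pins the class only up to NON-ZERO MULTIPLES, not up to units — the
series `L` absorbs the square of the multiplier. [cite: CastellaWan2023, proof of Thm. 6.8, Def. 6.1, Thm. 6.2, Cor. 6.4 (MS pp. 25–31)] -/
theorem TransferInputs.smul (h : TransferInputs W p κ γ hγ 𝔭 h𝔭 γ𝔭 hγ𝔭 𝔭' h𝔭𝔭' h𝔭p ε z L)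
    {u : IwasawaAlgebra p} (hu : u ≠ 0) (j₀ : ℤ_[p] →+* unrIntegers p)
    (hj₀ : ∀ x : ℤ_[p], ((j₀ x : unrIntegers p) : ℂ_[p]) = algebraMap ℚ_[p] ℂ_[p] (x : ℚ_[p])) :
    TransferInputs W p κ γ hγ 𝔭 h𝔭 γ𝔭 hγ𝔭 𝔭' h𝔭𝔭' h𝔭p ε
      (letI := selmerLambdaAdic.moduleOfGen W p κ γ hγ (fun _ ↦ PCond.sgn ε); u • z)
      (PowerSeries.map j₀ (IwasawaAlgebra.invol p u ^ 2) * L) := by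
  letI := selmerLambdaAdic.moduleOfGen W p κ γ hγ (fun _ ↦ PCond.sgn ε)
  letI := localSignedLambdaAdic.moduleOfGen (W.baseChange (𝔭.adicCompletion K)) p (localizeAt κ 𝔭 h𝔭)
    γ𝔭 (isTopGenerator_localize_of_apply_eq p κ _ h𝔭 hγ𝔭 hγ) ε
  have hloc : locSignedAt W p κ 𝔭 h𝔭 γ γ𝔭 hγ𝔭 (fun _ ↦ .sgn ε) ε rfl h𝔭p (u • z) =
      u • locSignedAt W p κ 𝔭 h𝔭 γ γ𝔭 hγ𝔭 (fun _ ↦ .sgn ε) ε rfl h𝔭p z :=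
    locSignedAt_smul W p κ 𝔭 h𝔭 hγ𝔭 hγ rfl h𝔭p u z
  refine ⟨h.torsionFree, h.exact613, h.exact612, h.lemma67, ?_, ?_⟩
  · -- the explicit reciprocity law for the rescaled pair
    obtain ⟨Log, hLog, herl⟩ := h.signedLog_erl
    refine ⟨Log, hLog, fun j hj ↦ ?_⟩
    have hjj : j = j₀ := ringHom_eq_of_compatible j j₀ hj hj₀
    subst hjj
    set a := Log (locSignedAt W p κ 𝔭 h𝔭 γ γ𝔭 hγ𝔭 (fun _ ↦ .sgn ε) ε rfl h𝔭p z) with ha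
    have hLa : Log (locSignedAt W p κ 𝔭 h𝔭 γ γ𝔭 hγ𝔭 (fun _ ↦ .sgn ε) ε rfl h𝔭p (u • z)) = u * a := by
      rw [hloc, hLog.1]
    have e1 : IwasawaAlgebra.invol p ((u * a) ^ 2) =
        IwasawaAlgebra.invol p u ^ 2 * IwasawaAlgebra.invol p (a ^ 2) := by
      rw [mul_pow, map_mul, map_pow]
    rw [hLa, e1, Ideal.map_span, Set.image_singleton, map_mul (PowerSeries.map j),
      ← Ideal.span_singleton_mul_span_singleton, ← Ideal.span_singleton_mul_span_singleton, herl j hj,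
      Ideal.map_span, Set.image_singleton]
  · -- `loc_𝔭(u • z)` is not torsion: `f · u · loc z = 0 ⇒ f u = 0 ⇒ f = 0`
    intro f hf
    rw [hloc, ← mul_smul] at hf
    exact (mul_eq_zero.mp (h.loc_nonTorsion (f * u) hf)).resolve_right hu

end Rescale

/-! ## §2 `char(Sel_ε/Λ(u • z)) = (u) · char(Sel_ε/Λz)` on the signed carrier -/

section CharIdeal

variable {K : Type} [Field K] [NumberField K] {W : WeierstrassCurve ℚ} {p : ℕ} [Fact p.Prime]
  {κ : ZpExtension K p} {γ : absoluteGaloisGroup K}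

/-- **`char(Sel_ε(K, 𝐓^ac)/Λ(u•z)) = (u)·char(Sel_ε(K, 𝐓^ac)/Λz)`** for `Sel_ε` finitely generated, `z`
torsion-free with `Sel_ε/Λz` torsion and `u ≠ 0` — the tree's `Module.charIdeal_quotient_span_smul_eq`
(multiplicativity along `0 → Λ/(u) → Sel/Λuz → Sel/Λz → 0`) on the carrier of `signedHeegnerCharIdeal`.
[cite: NeukirchSchmidtWingberg2008, Ch. V §3 (multiplicativity of characteristic ideals)] [cite: CastellaWan2023, Conj. 4.8 (3) (MS p. 22)] -/
theorem signedHeegnerCharIdeal_smul (hγ : κ.IsTopGenerator γ) (ε : ℤˣ)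
    (z : selmerLambdaAdic (W.baseChange K) p κ γ (fun _ ↦ .sgn ε))
    (hfin : letI := selmerLambdaAdic.moduleOfGen (W.baseChange K) p κ γ hγ (fun _ ↦ PCond.sgn ε)
      Module.Finite (IwasawaAlgebra p) (selmerLambdaAdic (W.baseChange K) p κ γ (fun _ ↦ .sgn ε)))
    (hfree : ∀ a : IwasawaAlgebra p,
      (letI := selmerLambdaAdic.moduleOfGen (W.baseChange K) p κ γ hγ (fun _ ↦ PCond.sgn ε); a • z) = 0 → a = 0)
    (htors : letI := selmerLambdaAdic.moduleOfGen (W.baseChange K) p κ γ hγ (fun _ ↦ PCond.sgn ε)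
      Module.IsTorsion (IwasawaAlgebra p)
        (selmerLambdaAdic (W.baseChange K) p κ γ (fun _ ↦ .sgn ε) ⧸ Submodule.span (IwasawaAlgebra p) {z}))
    {u : IwasawaAlgebra p} (hu : u ≠ 0) :
    signedHeegnerCharIdeal hγ ε
        (letI := selmerLambdaAdic.moduleOfGen (W.baseChange K) p κ γ hγ (fun _ ↦ PCond.sgn ε); u • z) =
      Ideal.span {u} * signedHeegnerCharIdeal hγ ε z := by
  letI := selmerLambdaAdic.moduleOfGen (W.baseChange K) p κ γ hγ (fun _ ↦ PCond.sgn ε)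
  haveI := hfin
  unfold signedHeegnerCharIdeal
  exact Module.charIdeal_quotient_span_smul_eq hfree htors hu

end CharIdeal

/-! ## §3 Algebra in `Λ = ℤ_p⟦T⟧`: `∀ m, ∃ k, (p^k)·I ⊆ (T^m)` forces `I = ⊥` -/

section Algebra

variable {p : ℕ} [Fact p.Prime]

/-- In `Λ = ℤ_p⟦T⟧`: if for every `m` some `p`-power multiple of the ideal `I` lies in `(T^m)`, then
`I = ⊥` (the `n`-th coefficient of `p^k · c` is `p^k · c_n`, and `ℤ_p` is a domain). [folklore] -/
theorem Ideal.eq_bot_of_forall_span_C_pow_mul_le_span_X_pow {I : Ideal (IwasawaAlgebra p)}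
    (h : ∀ m : ℕ, ∃ k : ℕ,
      Ideal.span {PowerSeries.C ((p : ℤ_[p]) ^ k)} * I ≤ Ideal.span {(PowerSeries.X : IwasawaAlgebra p) ^ m}) :
    I = ⊥ := by
  refine (Submodule.eq_bot_iff _).mpr fun c hc ↦ ?_
  ext n
  obtain ⟨k, hk⟩ := h (n + 1)
  have hmem : PowerSeries.C ((p : ℤ_[p]) ^ k) * c ∈ Ideal.span {(PowerSeries.X : IwasawaAlgebra p) ^ (n + 1)} :=
    hk (Ideal.mul_mem_mul (Ideal.mem_span_singleton_self _) hc)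
  rw [Ideal.mem_span_singleton] at hmem
  have hcoeff := (PowerSeries.X_pow_dvd_iff.mp hmem) n (Nat.lt_succ_self n)
  rw [PowerSeries.coeff_C_mul] at hcoeff
  have hpk : ((p : ℤ_[p]) ^ k) ≠ 0 := pow_ne_zero _ (NeZero.ne _)
  simpa using (mul_eq_zero.mp hcoeff).resolve_left hpk

/-- `ι(T^m) ≠ 0` (`ι` is injective). [folklore] -/
theorem invol_X_pow_ne_zero (m : ℕ) : IwasawaAlgebra.invol p ((PowerSeries.X : IwasawaAlgebra p) ^ m) ≠ 0 := by
  intro h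
  have h' := IwasawaAlgebra.invol_injective p (by rw [h, map_zero] : IwasawaAlgebra.invol p
    ((PowerSeries.X : IwasawaAlgebra p) ^ m) = IwasawaAlgebra.invol p 0)
  exact pow_ne_zero m PowerSeries.X_ne_zero h'

end Algebra

/-! ## §4 THE TIGHTNESS: a reversed-Howard statement over every admissible class is false -/

section Tightness

variable {K : Type} [Field K] [NumberField K] {W : WeierstrassCurve ℚ} {p : ℕ} [Fact p.Prime]
  {κ : ZpExtension K p} {γ : absoluteGaloisGroup K} {hγ : κ.IsTopGenerator γ}
  {𝔭 : HeightOneSpectrum (𝓞 K)} {h𝔭 : IsNonsplitIn κ 𝔭} {γ𝔭 : absoluteGaloisGroup (𝔭.adicCompletion K)}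
  {hγ𝔭 : κ (resGalOfEmb (closureEmb (K := K) (𝔭.adicCompletion K)) γ𝔭) = κ γ}
  {𝔭' : HeightOneSpectrum (𝓞 K)} {h𝔭𝔭' : 𝔭 ≠ 𝔭'} {h𝔭p : ((p : ℕ) : 𝓞 K) ∈ 𝔭.asIdeal} {ε : ℤˣ}
  {z₀ : selmerLambdaAdic (W.baseChange K) p κ γ (fun _ ↦ .sgn ε)} {L₀ : UnrSeries p}

/-- **TIGHTNESS (PROVED): the frame hypothesis cannot be dropped from the Eisenstein-direction residue.**
For `E/ℚ` with model `W` base-changed to `K`, suppose ONE pair `(z₀, L₀)` carries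
`AcSigned.TransferInputs … ε z₀ L₀` (as Castella–Wan's conjunct 3 supplies at `p > 3`, `p ∤ h_K`) and
`Sel_ε(K, 𝐓^ac)` is finitely generated of `Λ`-rank one (Longo–Vigni Thm. 1.4 + Castella–Wan Lemma
6.7 (1)), and a structure map `j₀ : ℤ_p → R₀` compatible with `ℤ_p ⊂ ℂ_p` exists. Then it is FALSE that
every pair `(z, L)` with `TransferInputs … ε z L` satisfies the reversed rational Howard inequality
`∃ k, (p^k)·char_t(X_ε) ⊆ ι(char(Sel_ε/Λz))²`: by §1 the pairs `(ι(T^m) • z₀, j₀(T^{2m})·L₀)` are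
admissible, by §2 their Heegner sides are `(T^{2m})·ι(char(Sel_ε/Λz₀))²`, so `char_t(X_ε)` would be
`p`-power-divisible by every `T^{2m}` (§3: `= ⊥`), while a characteristic ideal is never `⊥`
(`Module.charIdeal_ne_bot`). So the supplement's [R] `HPMCPlusRigidityRat` (Lines/admdef_transfer.lean
rev 2), which has exactly this `∀ (z, L)` shape, is not a registrable stub; the `±`-currency residue must
keep `IsCWBDPLFunction … L` (bdpline's Form T) or the `∃`-frame BDP shape (C⁺⁺_NS of admdef v2).
[cite: CastellaWan2023, Thm. 6.8 (i) and its proof (MS pp. 29–31)] [cite: Washington1997, §13.2] -/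
theorem TransferInputs.not_forall_reverseHoward
    (h₀ : TransferInputs (W.baseChange K) p κ γ hγ 𝔭 h𝔭 γ𝔭 hγ𝔭 𝔭' h𝔭𝔭' h𝔭p ε z₀ L₀)
    (hS : selmerLambdaAdic.HasRank (W.baseChange K) p κ γ hγ (fun _ ↦ .sgn ε) 1)
    (j₀ : ℤ_[p] →+* unrIntegers p)
    (hj₀ : ∀ x : ℤ_[p], ((j₀ x : unrIntegers p) : ℂ_[p]) = algebraMap ℚ_[p] ℂ_[p] (x : ℚ_[p])) :
    ¬ ∀ (z : selmerLambdaAdic (W.baseChange K) p κ γ (fun _ ↦ .sgn ε)) (L : UnrSeries p),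
        TransferInputs (W.baseChange K) p κ γ hγ 𝔭 h𝔭 γ𝔭 hγ𝔭 𝔭' h𝔭𝔭' h𝔭p ε z L →
        ∃ k : ℕ, Ideal.span {PowerSeries.C ((p : ℤ_[p]) ^ k)} *
            X.torsionCharIdeal (W.baseChange K) p κ ∅ (fun _ ↦ .sgn ε) hγ ≤
          (signedHeegnerCharIdeal hγ ε z).map (IwasawaAlgebra.invol p) ^ 2 := by
  intro H
  letI iS := selmerLambdaAdic.moduleOfGen (W.baseChange K) p κ γ hγ (fun _ ↦ PCond.sgn ε)
  have hfin : Module.Finite (IwasawaAlgebra p) (selmerLambdaAdic (W.baseChange K) p κ γ (fun _ ↦ .sgn ε)) :=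
    hS.1
  haveI := hfin
  -- `z₀` is torsion-free and `Sel_ε/Λz₀` is torsion (rank one)
  have hfree : ∀ a : IwasawaAlgebra p, a • z₀ = 0 → a = 0 := fun a ha ↦ h₀.smul_eq_zero_imp a ha
  haveI : Module.IsTorsionFree (IwasawaAlgebra p) (selmerLambdaAdic (W.baseChange K) p κ γ (fun _ ↦ .sgn ε)) :=
    Module.IsTorsionFree.of_smul_eq_zero (h₀.torsionFree (fun _ ↦ .sgn ε))
  have hrk : Module.rank (IwasawaAlgebra p) (selmerLambdaAdic (W.baseChange K) p κ γ (fun _ ↦ .sgn ε)) ≤ 1 := by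
    rw [← Module.finrank_eq_rank, hS.2, Nat.cast_one]
  have htors : Module.IsTorsion (IwasawaAlgebra p)
      (selmerLambdaAdic (W.baseChange K) p κ γ (fun _ ↦ .sgn ε) ⧸ Submodule.span (IwasawaAlgebra p) {z₀}) := by
    intro x
    obtain ⟨s, rfl⟩ := Submodule.Quotient.mk_surjective _ x
    obtain ⟨a, b, ha, hab⟩ := Module.exists_smul_eq_smul_of_rank_le_one hrk h₀.ne_zero s
    refine ⟨⟨a, mem_nonZeroDivisors_of_ne_zero ha⟩, ?_⟩
    rw [Submonoid.mk_smul, ← Submodule.Quotient.mk_smul, hab, Submodule.Quotient.mk_eq_zero]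
    exact Submodule.smul_mem _ b (Submodule.mem_span_singleton_self z₀)
  -- every `T^m` divides a `p`-power multiple of `char_t(X_ε)`: rescale by `u = ι(T^m)`
  have hX : X.torsionCharIdeal (W.baseChange K) p κ ∅ (fun _ ↦ .sgn ε) hγ = ⊥ := by
    refine Ideal.eq_bot_of_forall_span_C_pow_mul_le_span_X_pow fun m ↦ ?_
    have hu : IwasawaAlgebra.invol p ((PowerSeries.X : IwasawaAlgebra p) ^ m) ≠ 0 := invol_X_pow_ne_zero m
    obtain ⟨k, hk⟩ := H _ _ (TransferInputs.smul h₀ hu j₀ hj₀)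
    refine ⟨k, hk.trans ?_⟩
    rw [signedHeegnerCharIdeal_smul hγ ε z₀ hfin hfree htors hu, Ideal.map_mul,
      AcSigned.map_invol_span_singleton, IwasawaAlgebra.invol_invol, mul_pow, Ideal.span_singleton_pow,
      ← pow_mul]
    calc Ideal.span {(PowerSeries.X : IwasawaAlgebra p) ^ (m * 2)} *
          (signedHeegnerCharIdeal hγ ε z₀).map (IwasawaAlgebra.invol p) ^ 2
        ≤ Ideal.span {(PowerSeries.X : IwasawaAlgebra p) ^ (m * 2)} := Ideal.mul_le_right
      _ ≤ Ideal.span {(PowerSeries.X : IwasawaAlgebra p) ^ m} :=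
          Ideal.span_singleton_le_span_singleton.mpr (pow_dvd_pow _ (Nat.le_mul_of_pos_right m two_pos))
  exact Module.charIdeal_ne_bot _ _ hX

/-- **The supplement's exact shape is inconsistent (PROVED).** "For every `(z, L)` with `TransferInputs …
ε z L`: `Sel_ε` has `Λ`-rank one ∧ `X_ε` has `Λ`-rank one ∧ `∃ k, (p^k)·char_t(X_ε) ⊆ ι(char(Sel_ε/Λz))²`"
(the three conclusions of `AdmdefLine.HPMCPlusRigidityRat`, Lines/admdef_transfer.lean rev 2, at a fixed
frame) implies `False` as soon as ONE admissible pair `(z₀, L₀)` and a compatible structure map exist — the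
rank-one hypothesis of `not_forall_reverseHoward` is then supplied by the statement itself at `z₀`.
[cite: CastellaWan2023, Thm. 6.8 (i) (MS p. 30)] -/
theorem TransferInputs.not_forall_hasRank_reverseHoward
    (h₀ : TransferInputs (W.baseChange K) p κ γ hγ 𝔭 h𝔭 γ𝔭 hγ𝔭 𝔭' h𝔭𝔭' h𝔭p ε z₀ L₀)
    (j₀ : ℤ_[p] →+* unrIntegers p)
    (hj₀ : ∀ x : ℤ_[p], ((j₀ x : unrIntegers p) : ℂ_[p]) = algebraMap ℚ_[p] ℂ_[p] (x : ℚ_[p])) :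
    ¬ ∀ (z : selmerLambdaAdic (W.baseChange K) p κ γ (fun _ ↦ .sgn ε)) (L : UnrSeries p),
        TransferInputs (W.baseChange K) p κ γ hγ 𝔭 h𝔭 γ𝔭 hγ𝔭 𝔭' h𝔭𝔭' h𝔭p ε z L →
        selmerLambdaAdic.HasRank (W.baseChange K) p κ γ hγ (fun _ ↦ .sgn ε) 1 ∧
        X.HasRank (W.baseChange K) p κ ∅ (fun _ ↦ .sgn ε) hγ 1 ∧
        ∃ k : ℕ, Ideal.span {PowerSeries.C ((p : ℤ_[p]) ^ k)} *
            X.torsionCharIdeal (W.baseChange K) p κ ∅ (fun _ ↦ .sgn ε) hγ ≤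
          (signedHeegnerCharIdeal hγ ε z).map (IwasawaAlgebra.invol p) ^ 2 := by
  intro H
  exact TransferInputs.not_forall_reverseHoward h₀ (H z₀ L₀ h₀).1 j₀ hj₀ fun z L hT ↦ (H z L hT).2.2

end Tightness

end Summit.BirchSwinnertonDyer.BirchSwinnertonDyer.Theorems.SignedBaseChangeAcDivTransferInputsRescaling

end
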